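import Literature.AnabelianGeometry.AbsoluteAnabelian.AbsAnabProp121viiAssemblyProofs
import Literature.AnabelianGeometry.AbsoluteAnabelian.AbsAnabProp121viiUnramifiedCocycleProofs
import Literature.AnabelianGeometry.AbsoluteAnabelian.AbsAnabProp121viiTransportedCocycleProofs
import Literature.AnabelianGeometry.AbsoluteAnabelian.AbsAnabLevelFieldsProofs
import Literature.AnabelianGeometry.AbsoluteAnabelian.MLFReciprocityEquivariantProofs
import Literature.NumberTheory.GaloisRepresentations.LocalFieldFiniteExtensionIntegers
import Literature.NumberTheory.GaloisRepresentations.LocalWeilDatumValuation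
import Mathlib.FieldTheory.Galois.Infinite
import HarnessLib

/-!
# [AbsAnab] Prop 1.2.1 (vii) at a finite layer: the pair `(α, ψ̄)` DESCENDS to `(β, ψ̄_E)` on
# `Γ_{E₁} ≅ Γ_{E₂}`, `Ē₁^× ⥲ Ē₂^×`, still `β`-equivariant and uniformiser-preserving

S. Mochizuki, *The Absolute Anabelian Geometry of Hyperbolic Curves* (2004) [AbsAnab], §1.2,
Prop 1.2.1 (vii) p. 11 (lit key paper:url-e8f118cc205e) and its use in S. Mochizuki, *The geometry
of Frobenioids II* (2008) [FrdII], Thm 2.4 (ii) p. 21–22: "the natural isomorphisms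
`F_N(Aᵢ) ⥲ ℤ/Nℤ` are induced on subquotients by the invariant `H²(Gᵢ, μ(K̄ᵢ^×)) ⥲ ℚ/ℤ`
[NSW 7.1.4]" — i.e. for the open subgroup `H = Gal(K̄/E) ≤ G_K` of an object `A` with
`A_E = Spec E`, the invariant of `F_N(A) ≅ H²(H, μ_N)` IS the residue map of the local field `E`,
and Theorem 2.4 (ii) is [AbsAnab] Prop 1.2.1 (vii) applied to the LAYER pair `(E₁, E₂)`.

abc-iut cell, W12 = `plan/L1/SUBDAG-FrdII-Thm24.md` rows L22 `InvCompat` / L23 `SubquotientCompat`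
(holder abc-iut-w5-d201), PIECE A (the L4 side).  For MLFs `K₁`, `K₂` (valued form, char. `0`),
`α : Γ_{K₁} ≅ Γ_{K₂}`, `ψ̄ : K̄₁^× ⥲ K̄₂^×` `α`-equivariant carrying (absolute) units to units and
uniformisers of `K₁` to uniformisers of `K₂` (the three properties of sub-DAG row L02
`UnitsTransport`), and finite extensions `Eᵢ/Kᵢ` — given as TYPES with `[Algebra Kᵢ Eᵢ]`, made local
fields by the tree's `FiniteExtension.valuativeRel / topologicalSpace / isNonarchimedeanLocalField`
(prolonged valuation) — whose subgroups `Gal(K̄ᵢ/Eᵢ⁰) ≤ Γ_{Kᵢ}` correspond under `α`: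

* `exists_layerGaloisEquiv` — `β : Γ_{E₁} ≃ₜ* Γ_{E₂}` over `α` along the restrictions
  `Γ_{Eᵢ} ↪ Γ_{Kᵢ}` (`β = Φ₂ ∘ α| ∘ Φ₁⁻¹`, abc-iut-L4-d3's level pattern);
* `isAlphaEquivariant_layer` — `ψ̄_E := ι₂ ∘ ψ̄ ∘ ι₁⁻¹` (`ιᵢ : K̄ᵢ ≅ Ēᵢ` the chosen identifications)
  is `β`-equivariant;
* `preservesUniformizers_layer` — **`ψ̄_E` carries uniformisers of `E₁` to uniformisers of `E₂`**:
  `ψ̄_E` induces `φ : E₁^× → E₂^×` (fixed points, `β`-equivariance), units `↔` units (the units of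
  `𝒪_{Eᵢ}` are the elements `x` with `x`, `x⁻¹` integral over `𝒪_{Kᵢ}` — `PreservesAbsUnits` at the
  layer), so `ord_{E₂}(φ π) =: r` satisfies `ord_{E₂} ∘ φ = r · ord_{E₁}`; `r > 0` because
  `ψ̄ ϖ_{K₁}` is a uniformiser of `K₂` (`e₁ r = e₂`), and `r = 1` because `φ` is onto `E₂^×`;
* `layer_residueMap_compat` — hence **[AbsAnab] Prop 1.2.1 (vii) for the layer pair**:
  `inv_{E₂} ∘ T²_{(β, ψ̄_E|μ_N)} = inv_{E₁}` for the residue maps characterised by `IsInvariantMap`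
  (sub-DAG rows L00/L06a/L09a `statement_of`, `exists_isNormalizedUnramifiedCocycle`,
  `exists_transportedCocycle`).
Proof-only; universe `0`; classical local class field theory (Serre XIII–XIV, NSW (7.1.4));
nothing here bears on [IUTchIII] Cor. 3.12.
-/

noncomputable section

namespace Literature.AnabelianGeometry.AbsoluteAnabelian

namespace Prop121vii

open Field IntermediateField ValuativeRel
open scoped Valued
open Literature.NumberTheory.GaloisRepresentations
open Literature.NumberTheory.GaloisRepresentations.LocalWeilDatum
open Literature.NumberTheory.GaloisRepresentations.IsNonarchimedeanLocalField
open Literature.NumberTheory.GaloisRepresentations.DiscreteGaloisModule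

/-! ### `β : Γ_{E₁} ≅ Γ_{E₂}` over `α`, and the `β`-equivariance of `ψ̄_E` -/

section Pair

variable {K₁ K₂ : Type} [Field K₁] [Field K₂]
  {E₁ : Type} [Field E₁] [Algebra K₁ E₁] [Algebra.IsAlgebraic K₁ E₁]
  {E₂ : Type} [Field E₂] [Algebra K₂ E₂] [Algebra.IsAlgebraic K₂ E₂]

/-- **The layer isomorphism `β : Γ_{E₁} ≅ Γ_{E₂}` over `α`**: if `α : Γ_{K₁} ≅ Γ_{K₂}` carries
`Gal(K̄₁/E₁⁰)` onto `Gal(K̄₂/E₂⁰)`, then `β := Φ₂ ∘ α| ∘ Φ₁⁻¹` (`Φᵢ : Gal(K̄ᵢ/Eᵢ⁰) ≅ Γ_{Eᵢ}` the lifts)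
is an isomorphism of profinite groups with `res₂ ∘ β = α ∘ res₁` ("by varying `Aᵢ`", [FrdII] p. 20).
[cite: MochizukiAbsAnab2004, Prop 1.2.1 (vii) p.11] -/
theorem exists_layerGaloisEquiv (α : absoluteGaloisGroup K₁ ≃ₜ* absoluteGaloisGroup K₂)
    (hα : ∀ g : absoluteGaloisGroup K₁,
      g ∈ galFixing K₁ (embField K₁ E₁) ↔ α g ∈ galFixing K₂ (embField K₂ E₂)) :
    ∃ β : absoluteGaloisGroup E₁ ≃ₜ* absoluteGaloisGroup E₂,
      ∀ σ, absGaloisRestrict K₂ E₂ (β σ) = α (absGaloisRestrict K₁ E₁ σ) := by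
  obtain ⟨Φ₁, hΦ₁⟩ := exists_continuousMulEquiv_galFixing_embField K₁ E₁
  obtain ⟨Φ₂, hΦ₂⟩ := exists_continuousMulEquiv_galFixing_embField K₂ E₂
  let αr : galFixing K₁ (embField K₁ E₁) ≃ₜ* galFixing K₂ (embField K₂ E₂) :=
    { toFun := fun g => ⟨α g, (hα g).mp g.2⟩
      invFun := fun g' => ⟨α.symm g', (hα _).mpr (by rw [α.apply_symm_apply]; exact g'.2)⟩
      left_inv := fun g => Subtype.ext (α.symm_apply_apply (g : absoluteGaloisGroup K₁))
      right_inv := fun g' => Subtype.ext (α.apply_symm_apply (g' : absoluteGaloisGroup K₂))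
      map_mul' := fun g g' => Subtype.ext (map_mul α _ _)
      continuous_toFun := (α.continuous.comp continuous_subtype_val).subtype_mk _
      continuous_invFun := (α.symm.continuous.comp continuous_subtype_val).subtype_mk _ }
  refine ⟨(Φ₁.symm.trans αr).trans Φ₂, fun σ => ?_⟩
  have h1 : Φ₁ ⟨absGaloisRestrict K₁ E₁ σ, absGaloisRestrict_mem_galFixing K₁ E₁ σ⟩ = σ := by
    rw [hΦ₁]
    exact liftGal_absGaloisRestrict K₁ E₁ σ _
  have h2 : Φ₁.symm σ = ⟨absGaloisRestrict K₁ E₁ σ, absGaloisRestrict_mem_galFixing K₁ E₁ σ⟩ :=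
    Φ₁.injective (by rw [Φ₁.apply_symm_apply, h1])
  change absGaloisRestrict K₂ E₂ (Φ₂ (αr (Φ₁.symm σ))) = _
  rw [h2, hΦ₂]
  exact absGaloisRestrict_liftGal K₂ E₂ _

omit [Algebra.IsAlgebraic K₁ E₁] in
/-- The action of `σ ∈ Γ_E` on a unit of `K̄` viewed in `Ē` through the chosen `ι : K̄ ≅ Ē` is the
action of its restriction `res σ ∈ Γ_K`. [cite: TateCorvallis1979, (1.4.5)] -/
theorem smul_units_map_absClosureEmbedding (σ : absoluteGaloisGroup E₁) (x : (AlgebraicClosure K₁)ˣ) :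
    σ • Units.map (absClosureEmbedding K₁ E₁).toRingHom.toMonoidHom x =
      Units.map (absClosureEmbedding K₁ E₁).toRingHom.toMonoidHom (absGaloisRestrict K₁ E₁ σ • x) := by
  ext
  rw [Units.coe_smul, Units.coe_map, Units.coe_map, Units.coe_smul]
  exact (absGaloisRestrict_apply_smul K₁ E₁ σ (x : AlgebraicClosure K₁)).symm

/-- Every unit of `Ē` is the image of a unit of `K̄` under the chosen `ι : K̄ ≅ Ē`. [folklore] -/
private theorem exists_units_map_absClosureEmbedding_eq (y : (AlgebraicClosure E₁)ˣ) :
    ∃ x : (AlgebraicClosure K₁)ˣ, Units.map (absClosureEmbedding K₁ E₁).toRingHom.toMonoidHom x = y :=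
  ⟨Units.map ((absClosureEquiv K₁ E₁).symm : AlgebraicClosure E₁ →* AlgebraicClosure K₁) y,
    Units.ext (by
      rw [Units.coe_map, Units.coe_map, MonoidHom.coe_coe]
      exact (absClosureEquiv K₁ E₁).apply_symm_apply (y : AlgebraicClosure E₁))⟩

omit [Algebra.IsAlgebraic K₂ E₂] in
/-- **`ψ̄_E` is `β`-equivariant**: for `ψ̄` `α`-equivariant, `β` over `α` and `ψ̄_E` over `ψ̄`
(`ψ̄_E ∘ ι₁ = ι₂ ∘ ψ̄` on `K̄₁^×`), `ψ̄_E (σ·y) = β(σ)·ψ̄_E(y)`.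
[cite: MochizukiAbsAnab2004, Prop 1.2.1 (vi) p.10] -/
theorem isAlphaEquivariant_layer {α : absoluteGaloisGroup K₁ ≃ₜ* absoluteGaloisGroup K₂}
    {ψ : (AlgebraicClosure K₁)ˣ ≃* (AlgebraicClosure K₂)ˣ} (hψ : IsAlphaEquivariant α ψ)
    {β : absoluteGaloisGroup E₁ ≃ₜ* absoluteGaloisGroup E₂}
    (hβ : ∀ σ, absGaloisRestrict K₂ E₂ (β σ) = α (absGaloisRestrict K₁ E₁ σ))
    {ψE : (AlgebraicClosure E₁)ˣ ≃* (AlgebraicClosure E₂)ˣ}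
    (hψE : ∀ x : (AlgebraicClosure K₁)ˣ,
      ψE (Units.map (absClosureEmbedding K₁ E₁).toRingHom.toMonoidHom x) =
        Units.map (absClosureEmbedding K₂ E₂).toRingHom.toMonoidHom (ψ x)) :
    IsAlphaEquivariant β ψE := by
  intro σ y
  obtain ⟨x, rfl⟩ := exists_units_map_absClosureEmbedding_eq (K₁ := K₁) y
  rw [smul_units_map_absClosureEmbedding, hψE, hψ, hψE, ← hβ, smul_units_map_absClosureEmbedding]

/-- In characteristic `0`, a unit of `Ē` fixed by `Γ_E` comes from `E^×` (`Ē^{Γ_E} = E`, the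
Galois correspondence for `Ē/E`). [cite: MilneFT2022, Ch. 7] -/
theorem exists_units_map_algebraMap_eq_of_forall_smul (E : Type) [Field E] [CharZero E]
    (y : (AlgebraicClosure E)ˣ) (hy : ∀ σ : absoluteGaloisGroup E, σ • y = y) :
    ∃ z : Eˣ, Units.map (algebraMap E (AlgebraicClosure E) : E →* AlgebraicClosure E) z = y := by
  haveI : IsGalois E (AlgebraicClosure E) := {}
  have hmem : (y : AlgebraicClosure E) ∈ Set.range (algebraMap E (AlgebraicClosure E)) := by
    refine (InfiniteGalois.mem_range_algebraMap_iff_fixed (y : AlgebraicClosure E)).mpr fun σ => ?_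
    have h := congrArg Units.val (hy σ)
    rw [Units.coe_smul, absoluteGaloisGroup.smul_def] at h
    exact h
  obtain ⟨e, he⟩ := hmem
  have he0 : e ≠ 0 := fun h => y.ne_zero (by rw [← he, h, map_zero])
  exact ⟨Units.mk0 e he0, Units.ext (by rw [Units.coe_map, MonoidHom.coe_coe, Units.val_mk0, he])⟩

/-- **`ψ̄_E` induces `φ : E₁^× → E₂^×`**: a `β`-equivariant `ψ̄_E` carries the `Γ_{E₁}`-invariants
`E₁^× ⊆ Ē₁^×` to the `Γ_{E₂}`-invariants `E₂^×`, multiplicatively ("by varying `Aᵢ` and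
reconstructing the multiplicative group of the field", [FrdII] p. 21).
[cite: MochizukiFrdII2008, Thm 2.4 (ii) p.21] -/
theorem exists_baseUnitsHom [CharZero E₂] {β : absoluteGaloisGroup E₁ ≃ₜ* absoluteGaloisGroup E₂}
    {ψE : (AlgebraicClosure E₁)ˣ ≃* (AlgebraicClosure E₂)ˣ} (hβψ : IsAlphaEquivariant β ψE) :
    ∃ φ : E₁ˣ →* E₂ˣ, ∀ z : E₁ˣ,
      Units.map (algebraMap E₂ (AlgebraicClosure E₂) : E₂ →* AlgebraicClosure E₂) (φ z) =
        ψE (Units.map (algebraMap E₁ (AlgebraicClosure E₁) : E₁ →* AlgebraicClosure E₁) z) := by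
  have key : ∀ z : E₁ˣ, ∃ z₂ : E₂ˣ,
      Units.map (algebraMap E₂ (AlgebraicClosure E₂) : E₂ →* AlgebraicClosure E₂) z₂ =
        ψE (Units.map (algebraMap E₁ (AlgebraicClosure E₁) : E₁ →* AlgebraicClosure E₁) z) := by
    intro z
    refine exists_units_map_algebraMap_eq_of_forall_smul E₂ _ fun τ => ?_
    have h := hβψ (β.symm τ)
      (Units.map (algebraMap E₁ (AlgebraicClosure E₁) : E₁ →* AlgebraicClosure E₁) z)
    rw [ContinuousMulEquiv.apply_symm_apply] at h
    rw [← h]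
    congr 1
    ext
    rw [Units.coe_smul, Units.coe_map, MonoidHom.coe_coe, absoluteGaloisGroup.smul_def]
    exact AlgEquiv.commutes _ _
  choose φ hφ using key
  have hinj : Function.Injective
      (Units.map (algebraMap E₂ (AlgebraicClosure E₂) : E₂ →* AlgebraicClosure E₂)) :=
    Units.map_injective (f := (algebraMap E₂ (AlgebraicClosure E₂) : E₂ →* AlgebraicClosure E₂))
      (fun a b hab => (algebraMap E₂ (AlgebraicClosure E₂)).injective hab)
  refine ⟨{ toFun := φ, map_one' := hinj ?_, map_mul' := fun a b => hinj ?_ }, hφ⟩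
  · rw [hφ, map_one, map_one, map_one]
  · rw [hφ, map_mul, map_mul, map_mul, hφ, hφ]

/-- The unit of `K̄` attached to `z ∈ E^×`: `ι⁻¹(z) ∈ E⁰ ⊆ K̄`. [folklore] -/
private theorem units_map_absClosureEmbedding_embUnit (z : E₁ˣ) :
    Units.map (absClosureEmbedding K₁ E₁).toRingHom.toMonoidHom
        (Units.map ((embField K₁ E₁).val : embField K₁ E₁ →* AlgebraicClosure K₁)
          (Units.map (equivEmbField K₁ E₁ : E₁ →* embField K₁ E₁) z)) =
      Units.map (algebraMap E₁ (AlgebraicClosure E₁) : E₁ →* AlgebraicClosure E₁) z :=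
  Units.ext (by
    rw [Units.coe_map, Units.coe_map, Units.coe_map, Units.coe_map, MonoidHom.coe_coe,
      MonoidHom.coe_coe]
    exact absClosureEmbedding_equivEmbField K₁ E₁ (z : E₁))

end Pair

/-! ### Units and valuations at the layer -/

section Valuation

variable (F : Type) [Field F] [ValuativeRel F] [TopologicalSpace F] [IsNonarchimedeanLocalField F]

/-- `ord x ≥ 0` for a non-zero integer `x ∈ 𝒪_F`. [folklore] -/
private theorem ord_nonneg_of_mem_integer {x : F} (hx0 : x ≠ 0) (hx : x ∈ 𝒪[F]) : 0 ≤ ord F x := by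
  have h : valuation F x ≤ 1 := (Valuation.mem_integer_iff _ _).mp hx
  rw [valuation_eq_unifValue_zpow_ord F hx0, ← zpow_zero (unifValue F)] at h
  have hanti : StrictAnti (fun n : ℤ => unifValue F ^ n) :=
    zpow_right_strictAnti₀ (unifValue_pos F) (unifValue_lt_one F)
  exact hanti.le_iff_ge.mp h

/-- `ord x > 0` for a non-zero integer `x ∈ 𝒪_F` which is not a unit (`|x| ≠ 1`). [folklore] -/
private theorem ord_pos_of_mem_integer {x : F} (hx0 : x ≠ 0) (hx : x ∈ 𝒪[F])
    (hx1 : valuation F x ≠ 1) : 0 < ord F x := by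
  rcases (ord_nonneg_of_mem_integer F hx0 hx).lt_or_eq with h | h
  · exact h
  · exact absurd ((ord_eq_zero_iff F hx0).mp h.symm) hx1

end Valuation

section Layer

variable {K₁ K₂ : Type} [Field K₁] [ValuativeRel K₁] [TopologicalSpace K₁]
  [IsNonarchimedeanLocalField K₁] [CharZero K₁] [Field K₂] [ValuativeRel K₂] [TopologicalSpace K₂]
  [IsNonarchimedeanLocalField K₂] [CharZero K₂]
  {E₁ : Type} [Field E₁] [Algebra K₁ E₁] [FiniteDimensional K₁ E₁]
  {E₂ : Type} [Field E₂] [Algebra K₂ E₂] [FiniteDimensional K₂ E₂]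
  {ψ : (AlgebraicClosure K₁)ˣ ≃* (AlgebraicClosure K₂)ˣ}
  {ψE : (AlgebraicClosure E₁)ˣ ≃* (AlgebraicClosure E₂)ˣ}

/-- **Units `↔` units at the layer**: if `ψ̄` carries the absolute units of `K̄₁` to those of `K̄₂`
(`PreservesAbsUnits`) and `ψ̄_E` over `ψ̄` induces `φ : E₁^× → E₂^×`, then `z ∈ 𝒪_{E₁}^× ↔ φ z ∈ 𝒪_{E₂}^×`
for the prolonged valuations (`𝒪_{Eᵢ}^×` = the `x` with `x, x⁻¹` integral over `𝒪_{Kᵢ}`, Serre II §2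
Prop. 3; [AbsAnab] Prop 1.2.1 (iii) "`Im(𝒪^×_L)`" at the level `L = E`).
[cite: MochizukiAbsAnab2004, Prop 1.2.1 (iii) p.10] -/
theorem valuation_eq_one_iff_layer (hu : PreservesAbsUnits ψ)
    (hψE : ∀ x : (AlgebraicClosure K₁)ˣ,
      ψE (Units.map (absClosureEmbedding K₁ E₁).toRingHom.toMonoidHom x) =
        Units.map (absClosureEmbedding K₂ E₂).toRingHom.toMonoidHom (ψ x))
    {φ : E₁ˣ →* E₂ˣ}
    (hφ : ∀ z : E₁ˣ,
      Units.map (algebraMap E₂ (AlgebraicClosure E₂) : E₂ →* AlgebraicClosure E₂) (φ z) =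
        ψE (Units.map (algebraMap E₁ (AlgebraicClosure E₁) : E₁ →* AlgebraicClosure E₁) z))
    (z : E₁ˣ) :
    letI := FiniteExtension.valuativeRel K₁ E₁
    letI := FiniteExtension.valuativeRel K₂ E₂
    valuation E₁ (z : E₁) = 1 ↔ valuation E₂ (φ z : E₂) = 1 := by
  letI := FiniteExtension.valuativeRel K₁ E₁
  letI := FiniteExtension.valuativeRel K₂ E₂
  -- the units of `K̄ᵢ` attached to `z` and `φ z`
  let u₁ : (embField K₁ E₁)ˣ := Units.map (equivEmbField K₁ E₁ : E₁ →* embField K₁ E₁) z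
  let u₂ : (embField K₂ E₂)ˣ := Units.map (equivEmbField K₂ E₂ : E₂ →* embField K₂ E₂) (φ z)
  let x₁ : (AlgebraicClosure K₁)ˣ :=
    Units.map ((embField K₁ E₁).val : embField K₁ E₁ →* AlgebraicClosure K₁) u₁
  let x₂ : (AlgebraicClosure K₂)ˣ :=
    Units.map ((embField K₂ E₂).val : embField K₂ E₂ →* AlgebraicClosure K₂) u₂
  -- `ψ̄ x₁ = x₂`
  have hx : ψ x₁ = x₂ := by
    apply Units.map_injective (f := (absClosureEmbedding K₂ E₂).toRingHom.toMonoidHom)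
      (fun a b hab => (absClosureEquiv K₂ E₂).injective hab)
    rw [← hψE, units_map_absClosureEmbedding_embUnit, ← hφ, units_map_absClosureEmbedding_embUnit]
  have h₁ := coe_mem_absIntegers_iff_map_mem_unitGroup K₁ E₁ u₁
  have h₂ := coe_mem_absIntegers_iff_map_mem_unitGroup K₂ E₂ u₂
  have hz₁ : Units.map ((equivEmbField K₁ E₁).symm : embField K₁ E₁ →* E₁) u₁ = z :=
    Units.ext ((equivEmbField K₁ E₁).symm_apply_apply (z : E₁))
  have hz₂ : Units.map ((equivEmbField K₂ E₂).symm : embField K₂ E₂ →* E₂) u₂ = φ z :=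
    Units.ext ((equivEmbField K₂ E₂).symm_apply_apply (φ z : E₂))
  rw [hz₁, Valuation.mem_unitGroup_iff] at h₁
  rw [hz₂, Valuation.mem_unitGroup_iff] at h₂
  rw [← h₁, ← h₂]
  have e₁ : ((u₁ : embField K₁ E₁) : AlgebraicClosure K₁) = (x₁ : AlgebraicClosure K₁) := rfl
  have e₁' : ((↑u₁⁻¹ : embField K₁ E₁) : AlgebraicClosure K₁) = (↑x₁⁻¹ : AlgebraicClosure K₁) := by
    rw [← map_inv]; rfl
  have e₂ : ((u₂ : embField K₂ E₂) : AlgebraicClosure K₂) = (x₂ : AlgebraicClosure K₂) := rfl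
  have e₂' : ((↑u₂⁻¹ : embField K₂ E₂) : AlgebraicClosure K₂) = (↑x₂⁻¹ : AlgebraicClosure K₂) := by
    rw [← map_inv]; rfl
  rw [e₁, e₁', e₂, e₂', ← hx]
  exact hu x₁

omit [CharZero K₁] in
/-- `ord_E` of the image of a `K`-uniformiser is positive (`e ≥ 1`: the valuation of `E` prolongs
that of `K`). [cite: SerreLocalFields1979, Ch. II §2 Cor. 2] -/
private theorem ord_algebraMap_uniformizer_pos (ϖ : K₁ˣ) (hϖ : (valuation K₁).IsUniformizer (ϖ : K₁)) :
    letI := FiniteExtension.valuativeRel K₁ E₁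
    letI := FiniteExtension.topologicalSpace K₁ E₁
    haveI := FiniteExtension.isNonarchimedeanLocalField K₁ E₁
    0 < ord E₁ (algebraMap K₁ E₁ (ϖ : K₁)) := by
  letI := FiniteExtension.valuativeRel K₁ E₁
  letI := FiniteExtension.topologicalSpace K₁ E₁
  haveI := FiniteExtension.isNonarchimedeanLocalField K₁ E₁
  have h0 : algebraMap K₁ E₁ (ϖ : K₁) ≠ 0 :=
    (map_ne_zero_iff _ (algebraMap K₁ E₁).injective).mpr ϖ.ne_zero
  have hle : valuation K₁ (ϖ : K₁) ≤ 1 := hϖ.val_lt_one.le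
  have hmem : algebraMap K₁ E₁ (ϖ : K₁) ∈ 𝒪[E₁] :=
    FiniteExtension.algebraMap_mem_integer K₁ E₁ ⟨(ϖ : K₁), hle⟩
  refine ord_pos_of_mem_integer E₁ h0 hmem fun h1 => ?_
  -- `|ϖ|_E = 1` would make `ϖ⁻¹ ∈ 𝒪_E ∩ K = 𝒪_K`, i.e. `|ϖ⁻¹|_K ≤ 1`
  have hinv : (ϖ : K₁)⁻¹ ∈ 𝒪[K₁] := by
    rw [← FiniteExtension.mem_integer_algebraMap_iff K₁ E₁, map_inv₀]
    exact ((FiniteExtension.valuation_eq_one_iff_mem_integer_and_inv_mem K₁ E₁ h0).mp h1).2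
  have h2 : valuation K₁ ((ϖ : K₁)⁻¹) ≤ 1 := (Valuation.mem_integer_iff _ _).mp hinv
  rw [map_inv₀, inv_le_one₀ ((Valuation.pos_iff _).mpr ϖ.ne_zero)] at h2
  exact absurd (le_antisymm hle h2) hϖ.val_lt_one.ne

/-- **`ψ̄_E` carries uniformisers of `E₁` to uniformisers of `E₂`** (the layer form of
"`ψ̄` preserves `Im(K^×)` and the Frobenius orientation", [AbsAnab] Prop 1.2.1 (iii)/(iv); used
implicitly in [FrdII] Thm 2.4 (ii) p. 21 "induced on subquotients"): for the prolonged valuations on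
`E₁/K₁`, `E₂/K₂`, the `β`-equivariant lift `ψ̄_E` of an `α`-equivariant `ψ̄` preserving absolute
units and `K`-uniformisers satisfies `PreservesUniformizers ψ̄_E`.  Proof: `ord_{E₂} ∘ φ = r · ord_{E₁}`
on `E₁^×` with `r = ord_{E₂}(φ π)`; `e₁ · r = e₂ > 0`; and `φ` is onto `E₂^×`, so `r = 1`.
[cite: MochizukiAbsAnab2004, Prop 1.2.1 (vii) p.11] -/
theorem preservesUniformizers_layer {α : absoluteGaloisGroup K₁ ≃ₜ* absoluteGaloisGroup K₂}
    (hψ : IsAlphaEquivariant α ψ) (hu : PreservesAbsUnits ψ) (hunif : PreservesUniformizers ψ)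
    {β : absoluteGaloisGroup E₁ ≃ₜ* absoluteGaloisGroup E₂}
    (hβ : ∀ σ, absGaloisRestrict K₂ E₂ (β σ) = α (absGaloisRestrict K₁ E₁ σ))
    (hψE : ∀ x : (AlgebraicClosure K₁)ˣ,
      ψE (Units.map (absClosureEmbedding K₁ E₁).toRingHom.toMonoidHom x) =
        Units.map (absClosureEmbedding K₂ E₂).toRingHom.toMonoidHom (ψ x)) :
    letI := FiniteExtension.valuativeRel K₁ E₁
    letI := FiniteExtension.topologicalSpace K₁ E₁
    haveI := FiniteExtension.isNonarchimedeanLocalField K₁ E₁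
    letI := FiniteExtension.valuativeRel K₂ E₂
    letI := FiniteExtension.topologicalSpace K₂ E₂
    haveI := FiniteExtension.isNonarchimedeanLocalField K₂ E₂
    PreservesUniformizers ψE := by
  letI := FiniteExtension.valuativeRel K₁ E₁
  letI := FiniteExtension.topologicalSpace K₁ E₁
  haveI := FiniteExtension.isNonarchimedeanLocalField K₁ E₁
  letI := FiniteExtension.valuativeRel K₂ E₂
  letI := FiniteExtension.topologicalSpace K₂ E₂
  haveI := FiniteExtension.isNonarchimedeanLocalField K₂ E₂
  haveI : CharZero E₁ := charZero_of_injective_algebraMap (algebraMap K₁ E₁).injective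
  haveI : CharZero E₂ := charZero_of_injective_algebraMap (algebraMap K₂ E₂).injective
  have hβψ : IsAlphaEquivariant β ψE := isAlphaEquivariant_layer hψ hβ hψE
  -- the induced homomorphisms `φ : E₁ˣ → E₂ˣ`, `φ' : E₂ˣ → E₁ˣ` and `φ ∘ φ' = id`
  obtain ⟨φ, hφ⟩ := exists_baseUnitsHom hβψ
  obtain ⟨φ', hφ'⟩ := exists_baseUnitsHom (isAlphaEquivariant_symm hβψ)
  have hφφ' : ∀ w : E₂ˣ, φ (φ' w) = w := fun w => by
    apply Units.map_injective (f := (algebraMap E₂ (AlgebraicClosure E₂) : E₂ →* AlgebraicClosure E₂))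
      (fun a b hab => (algebraMap E₂ (AlgebraicClosure E₂)).injective hab)
    rw [hφ, hφ', MulEquiv.apply_symm_apply]
  -- units ↔ units, hence `ord = 0 ↔ ord = 0`
  have hval : ∀ z : E₁ˣ, valuation E₁ (z : E₁) = 1 ↔ valuation E₂ (φ z : E₂) = 1 :=
    valuation_eq_one_iff_layer hu hψE hφ
  have hord0 : ∀ z : E₁ˣ, ord E₁ (z : E₁) = 0 → ord E₂ (φ z : E₂) = 0 := fun z hz => by
    rw [ord_eq_zero_iff E₂ (φ z).ne_zero]
    exact (hval z).mp ((ord_eq_zero_iff E₁ z.ne_zero).mp hz)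
  -- a uniformiser `π` of `E₁` and `r := ord_{E₂} (φ π)`
  intro π₁ hπ₁
  refine ⟨φ π₁, ?_, (hφ π₁).symm⟩
  have hπord : ord E₁ (π₁ : E₁) = 1 := (ord_eq_one_iff E₁ π₁.ne_zero).mpr hπ₁
  rw [← ord_eq_one_iff E₂ (φ π₁).ne_zero]
  -- `ord₂ (φ z) = n r` whenever `ord₁ z = n ≥ 0`
  have hmul : ∀ (z : E₁ˣ) (n : ℕ), ord E₁ (z : E₁) = n →
      ord E₂ (φ z : E₂) = n * ord E₂ (φ π₁ : E₂) := fun z n hz => by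
    have hu0 : ord E₁ ((z * (π₁ ^ n)⁻¹ : E₁ˣ) : E₁) = 0 := by
      rw [Units.val_mul, Units.val_inv_eq_inv_val, ← div_eq_mul_inv, Units.val_pow_eq_pow_val,
        ord_div E₁ z.ne_zero (pow_ne_zero _ π₁.ne_zero), ord_pow E₁ π₁.ne_zero, hz, hπord]
      ring
    have h := hord0 _ hu0
    rw [map_mul, map_inv, map_pow, Units.val_mul, Units.val_inv_eq_inv_val, ← div_eq_mul_inv,
      Units.val_pow_eq_pow_val, ord_div E₂ (φ z).ne_zero (pow_ne_zero _ (φ π₁).ne_zero),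
      ord_pow E₂ (φ π₁).ne_zero] at h
    linarith
  -- `r > 0`: `ψ̄ ϖ_{K₁} = ϖ_{K₂}` gives `e₁ r = e₂ > 0`
  obtain ⟨ϖ₁, hϖ₁⟩ := exists_units_isUniformizer (F := K₁)
  obtain ⟨ϖ₂, hϖ₂, hψϖ⟩ := hunif ϖ₁ hϖ₁
  have he₁ := ord_algebraMap_uniformizer_pos (E₁ := E₁) ϖ₁ hϖ₁
  have he₂ := ord_algebraMap_uniformizer_pos (E₁ := E₂) ϖ₂ hϖ₂
  have hφϖ : φ (Units.map (algebraMap K₁ E₁ : K₁ →* E₁) ϖ₁) =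
      Units.map (algebraMap K₂ E₂ : K₂ →* E₂) ϖ₂ := by
    apply Units.map_injective (f := (algebraMap E₂ (AlgebraicClosure E₂) : E₂ →* AlgebraicClosure E₂))
      (fun a b hab => (algebraMap E₂ (AlgebraicClosure E₂)).injective hab)
    rw [hφ]
    have k₁ : Units.map (algebraMap E₁ (AlgebraicClosure E₁) : E₁ →* AlgebraicClosure E₁)
        (Units.map (algebraMap K₁ E₁ : K₁ →* E₁) ϖ₁) =
      Units.map (absClosureEmbedding K₁ E₁).toRingHom.toMonoidHom
        (Units.map (algebraMap K₁ (AlgebraicClosure K₁) : K₁ →* AlgebraicClosure K₁) ϖ₁) :=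
      Units.ext (by
        rw [Units.coe_map, Units.coe_map, Units.coe_map, Units.coe_map, MonoidHom.coe_coe,
          MonoidHom.coe_coe, MonoidHom.coe_coe, ← IsScalarTower.algebraMap_apply]
        exact ((absClosureEmbedding K₁ E₁).commutes (ϖ₁ : K₁)).symm)
    have k₂ : Units.map (algebraMap E₂ (AlgebraicClosure E₂) : E₂ →* AlgebraicClosure E₂)
        (Units.map (algebraMap K₂ E₂ : K₂ →* E₂) ϖ₂) =
      Units.map (absClosureEmbedding K₂ E₂).toRingHom.toMonoidHom
        (Units.map (algebraMap K₂ (AlgebraicClosure K₂) : K₂ →* AlgebraicClosure K₂) ϖ₂) :=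
      Units.ext (by
        rw [Units.coe_map, Units.coe_map, Units.coe_map, Units.coe_map, MonoidHom.coe_coe,
          MonoidHom.coe_coe, MonoidHom.coe_coe, ← IsScalarTower.algebraMap_apply]
        exact ((absClosureEmbedding K₂ E₂).commutes (ϖ₂ : K₂)).symm)
    rw [k₁, hψE, hψϖ, k₂]
  have hrpos : 0 < ord E₂ (φ π₁ : E₂) := by
    have h := hmul (Units.map (algebraMap K₁ E₁ : K₁ →* E₁) ϖ₁) (ord E₁ (algebraMap K₁ E₁ (ϖ₁ : K₁))).toNat
      (by rw [Units.coe_map, MonoidHom.coe_coe, Int.toNat_of_nonneg he₁.le])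
    rw [hφϖ, Units.coe_map, MonoidHom.coe_coe] at h
    have h' : (0 : ℤ) < ((ord E₁ (algebraMap K₁ E₁ (ϖ₁ : K₁))).toNat : ℤ) * ord E₂ (φ π₁ : E₂) := by
      rw [← h]; exact he₂
    exact pos_of_mul_pos_right h' (by positivity)
  -- `r ∣ 1`: `φ` is onto, take `z` with `φ z = π₂` and shift by a power of `π₁`
  obtain ⟨π₂, hπ₂⟩ := exists_units_isUniformizer (F := E₂)
  set z := φ' π₂ with hzdef
  set m := (ord E₁ (z : E₁)).natAbs with hmdef
  have hzm : ord E₁ ((z * π₁ ^ m : E₁ˣ) : E₁) = ((ord E₁ (z : E₁) + m).toNat : ℕ) := by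
    rw [Units.val_mul, Units.val_pow_eq_pow_val, ord_mul E₁ z.ne_zero (pow_ne_zero _ π₁.ne_zero),
      ord_pow E₁ π₁.ne_zero, hπord, mul_one, Int.toNat_of_nonneg]
    omega
  have h := hmul (z * π₁ ^ m) _ hzm
  rw [map_mul, map_pow, hφφ', Units.val_mul, Units.val_pow_eq_pow_val,
    ord_mul E₂ π₂.ne_zero (pow_ne_zero _ (φ π₁).ne_zero), ord_pow E₂ (φ π₁).ne_zero,
    (ord_eq_one_iff E₂ π₂.ne_zero).mpr hπ₂] at h
  -- `1 + m r = (ord z + m) r`, so `r ∣ 1`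
  have hm : ((ord E₁ (z : E₁) + m).toNat : ℤ) = ord E₁ (z : E₁) + m := by
    rw [Int.toNat_of_nonneg]; omega
  rw [hm] at h
  have hdvd : ord E₂ (φ π₁ : E₂) ∣ 1 := ⟨ord E₁ (z : E₁), by linarith⟩
  exact Int.eq_one_of_dvd_one hrpos.le hdvd

/-! ### [AbsAnab] Prop 1.2.1 (vii) for the layer pair -/

omit [ValuativeRel K₁] [TopologicalSpace K₁] [IsNonarchimedeanLocalField K₁] [CharZero K₁]
  [ValuativeRel K₂] [TopologicalSpace K₂] [IsNonarchimedeanLocalField K₂] [CharZero K₂]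
  [FiniteDimensional K₁ E₁] [FiniteDimensional K₂ E₂] in
/-- An element of `E^×` gives a `Γ_E`-invariant of the discrete module `Ē^×` with that value.
[folklore] -/
private theorem exists_invariant_unitsVal_eq_map (E : Type) [Field E] (x : Eˣ) :
    ∃ u : (units E).toTopRep.ρ.invariants,
      unitsVal E (u : UnitsCarrier E) = Units.map (algebraMap E (AlgebraicClosure E) : E →* _) x := by
  refine ⟨⟨UnitsCarrier.ofUnits (Units.map (algebraMap E (AlgebraicClosure E) : E →* _) x),
    fun σ => ?_⟩, rfl⟩
  apply unitsVal_injective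
  change unitsVal E (units E σ _) = _
  rw [unitsVal_apply, unitsVal_ofUnits]
  ext
  rw [Units.coe_smul, Units.coe_map, MonoidHom.coe_coe, absoluteGaloisGroup.smul_def, AlgEquiv.commutes]

omit [ValuativeRel K₁] [TopologicalSpace K₁] [IsNonarchimedeanLocalField K₁] [CharZero K₁]
  [ValuativeRel K₂] [TopologicalSpace K₂] [IsNonarchimedeanLocalField K₂] [CharZero K₂]
  [FiniteDimensional K₁ E₁] [FiniteDimensional K₂ E₂] in
/-- Two additive maps to `ℤ/n` agree as soon as they agree on an element `c` with `inv c = 1` for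
some additive bijection `inv` onto `ℤ/n` (`c` generates). [folklore] -/
private theorem addMonoidHom_eq_of_bijective_of_apply_eq' {A : Type*} [AddCommGroup A] {n : ℕ}
    [NeZero n] (inv : A →+ ZMod n) (hinv : Function.Bijective inv) {c : A} (hc : inv c = 1)
    (φ φ' : A →+ ZMod n) (h : φ c = φ' c) : φ = φ' := by
  refine AddMonoidHom.ext fun x => ?_
  have hx : x = (inv x).val • c := hinv.1 (by
    rw [map_nsmul, hc, nsmul_eq_mul, mul_one, ZMod.natCast_zmod_val])
  rw [hx, map_nsmul, map_nsmul, h]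

/-- **[AbsAnab] Prop 1.2.1 (vii) for the layer pair `(E₁, E₂)`** — the content of [FrdII]
Thm 2.4 (ii) "the natural isomorphisms `F_N(Aᵢ) ⥲ ℤ/Nℤ` [induced on subquotients by the invariant,
NSW 7.1.4] are compatible with `F_N(A₁) ⥲ F_N(A₂)`": for `ψ̄` `α`-equivariant carrying absolute
units to units and `K₁`-uniformisers to `K₂`-uniformisers, `β : Γ_{E₁} ≅ Γ_{E₂}` over `α` and `ψ̄_E`
over `ψ̄`, every `N ≥ 1` and the residue maps `inv₁`, `inv₂` of the local fields `E₁`, `E₂`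
(characterised by `IsInvariantMap`, prolonged valuations): `inv₂ ∘ T²_{(β, ψ̄_E|μ_N)} = inv₁` on
`H²(Γ_{E₁}, μ_N)` (rows L06a/L09a/L01a/L08 of the sub-DAG at the layer, with
`preservesUniformizers_layer`). [cite: MochizukiAbsAnab2004, Prop 1.2.1 (vii) p.11] -/
theorem layer_residueMap_compat {α : absoluteGaloisGroup K₁ ≃ₜ* absoluteGaloisGroup K₂}
    (hψ : IsAlphaEquivariant α ψ) (hu : PreservesAbsUnits ψ) (hunif : PreservesUniformizers ψ)
    {β : absoluteGaloisGroup E₁ ≃ₜ* absoluteGaloisGroup E₂}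
    (hβ : ∀ σ, absGaloisRestrict K₂ E₂ (β σ) = α (absGaloisRestrict K₁ E₁ σ))
    (hψE : ∀ x : (AlgebraicClosure K₁)ˣ,
      ψE (Units.map (absClosureEmbedding K₁ E₁).toRingHom.toMonoidHom x) =
        Units.map (absClosureEmbedding K₂ E₂).toRingHom.toMonoidHom (ψ x))
    (N : ℕ) [NeZero N] [Finite (MuCarrier E₁ N)] [Finite (MuCarrier E₂ N)]
    (hμ : IsEquivariantOver β (mu E₁ N) (mu E₂ N) (muCarrierMap ψE.toMonoidHom N))
    (inv₁ : galoisCohomology (mu E₁ N) 2 →+ ZMod N) (inv₂ : galoisCohomology (mu E₂ N) 2 →+ ZMod N) :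
    letI := FiniteExtension.valuativeRel K₁ E₁
    letI := FiniteExtension.topologicalSpace K₁ E₁
    haveI := FiniteExtension.isNonarchimedeanLocalField K₁ E₁
    letI := FiniteExtension.valuativeRel K₂ E₂
    letI := FiniteExtension.topologicalSpace K₂ E₂
    haveI := FiniteExtension.isNonarchimedeanLocalField K₂ E₂
    IsInvariantMap E₁ N inv₁ → IsInvariantMap E₂ N inv₂ →
      inv₂.comp (cohTransport β (mu E₁ N) (mu E₂ N) (muCarrierMap ψE.toMonoidHom N) hμ 2) = inv₁ := by
  letI := FiniteExtension.valuativeRel K₁ E₁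
  letI := FiniteExtension.topologicalSpace K₁ E₁
  haveI := FiniteExtension.isNonarchimedeanLocalField K₁ E₁
  letI := FiniteExtension.valuativeRel K₂ E₂
  letI := FiniteExtension.topologicalSpace K₂ E₂
  haveI := FiniteExtension.isNonarchimedeanLocalField K₂ E₂
  intro hinv₁ hinv₂
  haveI : CharZero E₁ := charZero_of_injective_algebraMap (algebraMap K₁ E₁).injective
  haveI : CharZero E₂ := charZero_of_injective_algebraMap (algebraMap K₂ E₂).injective
  haveI : CompactSpace (absoluteGaloisGroup E₁) := absoluteGaloisGroup_compactSpace E₁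
  haveI : CompactSpace (absoluteGaloisGroup E₂) := absoluteGaloisGroup_compactSpace E₂
  have hβψ : IsAlphaEquivariant β ψE := isAlphaEquivariant_layer hψ hβ hψE
  have hunifE : PreservesUniformizers ψE := preservesUniformizers_layer hψ hu hunif hβ hψE
  -- the data on side 1 (row L06a at the layer `E₁`)
  obtain ⟨g₁, hg₁n⟩ := exists_isNormalizedUnramifiedCocycle E₁ N
  obtain ⟨π₁, hπ₁⟩ := exists_units_isUniformizer (F := E₁)
  obtain ⟨u₁, hu₁⟩ := exists_invariant_unitsVal_eq_map E₁ π₁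
  -- the transported data on side 2 (row L09a at the layer pair)
  obtain ⟨g₂, hg₂n, hg⟩ := exists_transportedCocycle β ψE N hβψ g₁ hg₁n
  obtain ⟨π₂, hπ₂, hψπ⟩ := hunifE π₁ hπ₁
  obtain ⟨u₂, hu₂⟩ := exists_invariant_unitsVal_eq_map E₂ π₂
  have hu12 : ψE (unitsVal E₁ (u₁ : UnitsCarrier E₁)) = unitsVal E₂ (u₂ : UnitsCarrier E₂) := by
    rw [hu₁, hu₂, hψπ]
  have hu₁' : (unitsVal E₁ (u₁ : UnitsCarrier E₁) : AlgebraicClosure E₁) =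
      algebraMap E₁ (AlgebraicClosure E₁) (π₁ : E₁) := by rw [hu₁]; rfl
  have hu₂' : (unitsVal E₂ (u₂ : UnitsCarrier E₂) : AlgebraicClosure E₂) =
      algebraMap E₂ (AlgebraicClosure E₂) (π₂ : E₂) := by rw [hu₂]; rfl
  -- the canonical classes have residue `1`
  obtain ⟨hbij₁, hnorm₁⟩ := hinv₁
  obtain ⟨_, hnorm₂⟩ := hinv₂
  have h1 : inv₁ (((mu E₁ N).tateDualPairing N).cupProduct
      ((isSES_kummer E₁ N (NeZero.pos N)).δ₀ u₁) (oneCocycleClass _ g₁)) = 1 :=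
    hnorm₁ g₁ hg₁n (π₁ : E₁) hπ₁ u₁ hu₁'
  have h2 : inv₂ (((mu E₂ N).tateDualPairing N).cupProduct
      ((isSES_kummer E₂ N (NeZero.pos N)).δ₀ u₂) (oneCocycleClass _ g₂)) = 1 :=
    hnorm₂ g₂ hg₂n (π₂ : E₂) hπ₂ u₂ hu₂'
  -- transport of the canonical class (rows L01a and L08 at the layer pair)
  have hT : cohTransport β (mu E₁ N) (mu E₂ N) (muCarrierMap ψE.toMonoidHom N) hμ 2
        (((mu E₁ N).tateDualPairing N).cupProduct ((isSES_kummer E₁ N (NeZero.pos N)).δ₀ u₁)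
          (oneCocycleClass _ g₁)) =
      ((mu E₂ N).tateDualPairing N).cupProduct ((isSES_kummer E₂ N (NeZero.pos N)).δ₀ u₂)
        (oneCocycleClass _ g₂) := by
    rw [cohTransportCup_holds β ψE N hμ g₁ g₂ hg,
      kummerUniformizerTransport_holds β ψE N hβψ u₁ u₂ hu12]
  -- `c₁` generates
  refine addMonoidHom_eq_of_bijective_of_apply_eq' inv₁ hbij₁ h1 _ _ ?_
  rw [AddMonoidHom.comp_apply, hT, h2, h1]

end Layer

/-! ### The packaged descent -/

section Package

variable {K₁ K₂ : Type} [Field K₁] [ValuativeRel K₁] [TopologicalSpace K₁]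
  [IsNonarchimedeanLocalField K₁] [CharZero K₁] [Field K₂] [ValuativeRel K₂] [TopologicalSpace K₂]
  [IsNonarchimedeanLocalField K₂] [CharZero K₂]
  (E₁ : Type) [Field E₁] [Algebra K₁ E₁] [FiniteDimensional K₁ E₁]
  (E₂ : Type) [Field E₂] [Algebra K₂ E₂] [FiniteDimensional K₂ E₂]

omit [ValuativeRel K₁] [TopologicalSpace K₁] [IsNonarchimedeanLocalField K₁] [CharZero K₁]
  [ValuativeRel K₂] [TopologicalSpace K₂] [IsNonarchimedeanLocalField K₂] [CharZero K₂] in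
/-- **The layer pair `(β, ψ̄_E)` exists**: for `α : Γ_{K₁} ≅ Γ_{K₂}` carrying `Gal(K̄₁/E₁⁰)` onto
`Gal(K̄₂/E₂⁰)` and any `ψ̄ : K̄₁^× ⥲ K̄₂^×`, there are `β : Γ_{E₁} ≅ Γ_{E₂}` over `α` and
`ψ̄_E : Ē₁^× ⥲ Ē₂^×` over `ψ̄` (`ψ̄_E := ι₂ ∘ ψ̄ ∘ ι₁⁻¹`). [cite: MochizukiFrdII2008, Thm 2.4 (ii) p.21] -/
theorem exists_layerPair (α : absoluteGaloisGroup K₁ ≃ₜ* absoluteGaloisGroup K₂)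
    (hα : ∀ g : absoluteGaloisGroup K₁,
      g ∈ galFixing K₁ (embField K₁ E₁) ↔ α g ∈ galFixing K₂ (embField K₂ E₂))
    (ψ : (AlgebraicClosure K₁)ˣ ≃* (AlgebraicClosure K₂)ˣ) :
    ∃ (β : absoluteGaloisGroup E₁ ≃ₜ* absoluteGaloisGroup E₂)
      (ψE : (AlgebraicClosure E₁)ˣ ≃* (AlgebraicClosure E₂)ˣ),
      (∀ σ, absGaloisRestrict K₂ E₂ (β σ) = α (absGaloisRestrict K₁ E₁ σ)) ∧
        ∀ x : (AlgebraicClosure K₁)ˣ,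
          ψE (Units.map (absClosureEmbedding K₁ E₁).toRingHom.toMonoidHom x) =
            Units.map (absClosureEmbedding K₂ E₂).toRingHom.toMonoidHom (ψ x) := by
  obtain ⟨β, hβ⟩ := exists_layerGaloisEquiv (E₁ := E₁) (E₂ := E₂) α hα
  refine ⟨β, ((Units.mapEquiv (absClosureEquiv K₁ E₁).toRingEquiv.toMulEquiv).symm.trans ψ).trans
    (Units.mapEquiv (absClosureEquiv K₂ E₂).toRingEquiv.toMulEquiv), hβ, fun x => ?_⟩
  have hx : (Units.mapEquiv (absClosureEquiv K₁ E₁).toRingEquiv.toMulEquiv).symm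
      (Units.map (absClosureEmbedding K₁ E₁).toRingHom.toMonoidHom x) = x := by
    rw [MulEquiv.symm_apply_eq]
    exact Units.ext (by rw [Units.coe_mapEquiv, Units.coe_map]; rfl)
  rw [MulEquiv.trans_apply, MulEquiv.trans_apply, hx]
  exact Units.ext (by rw [Units.coe_mapEquiv, Units.coe_map]; rfl)

/-- **The descent, packaged** ([AbsAnab] Prop 1.2.1 (vii) "preserves the residue map" transported to
an arbitrary finite layer `Eᵢ/Kᵢ`, as consumed by [FrdII] Thm 2.4 (ii) "induced on subquotients"):
for `ψ̄` `α`-equivariant with absolute units to units and `K`-uniformisers to uniformisers, there are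
`β : Γ_{E₁} ≅ Γ_{E₂}` over `α` and `ψ̄_E : Ē₁^× ⥲ Ē₂^×` over `ψ̄`, `β`-equivariant, carrying
uniformisers of `E₁` to uniformisers of `E₂` (prolonged valuations), and intertwining the residue maps
at every level `N`: `inv₂ ∘ T²_{(β, ψ̄_E|μ_N)} = inv₁`. [cite: MochizukiAbsAnab2004, Prop 1.2.1 (vii) p.11] -/
theorem exists_layerTransport (α : absoluteGaloisGroup K₁ ≃ₜ* absoluteGaloisGroup K₂)
    (hα : ∀ g : absoluteGaloisGroup K₁,
      g ∈ galFixing K₁ (embField K₁ E₁) ↔ α g ∈ galFixing K₂ (embField K₂ E₂))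
    (ψ : (AlgebraicClosure K₁)ˣ ≃* (AlgebraicClosure K₂)ˣ) (hψ : IsAlphaEquivariant α ψ)
    (hu : PreservesAbsUnits ψ) (hunif : PreservesUniformizers ψ) :
    letI := FiniteExtension.valuativeRel K₁ E₁
    letI := FiniteExtension.topologicalSpace K₁ E₁
    haveI := FiniteExtension.isNonarchimedeanLocalField K₁ E₁
    letI := FiniteExtension.valuativeRel K₂ E₂
    letI := FiniteExtension.topologicalSpace K₂ E₂
    haveI := FiniteExtension.isNonarchimedeanLocalField K₂ E₂
    ∃ (β : absoluteGaloisGroup E₁ ≃ₜ* absoluteGaloisGroup E₂)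
      (ψE : (AlgebraicClosure E₁)ˣ ≃* (AlgebraicClosure E₂)ˣ),
      (∀ σ, absGaloisRestrict K₂ E₂ (β σ) = α (absGaloisRestrict K₁ E₁ σ)) ∧
      (∀ x : (AlgebraicClosure K₁)ˣ,
          ψE (Units.map (absClosureEmbedding K₁ E₁).toRingHom.toMonoidHom x) =
            Units.map (absClosureEmbedding K₂ E₂).toRingHom.toMonoidHom (ψ x)) ∧
      IsAlphaEquivariant β ψE ∧ PreservesUniformizers ψE ∧
      ∀ (N : ℕ) [NeZero N] [Finite (MuCarrier E₁ N)] [Finite (MuCarrier E₂ N)]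
        (hμ : IsEquivariantOver β (mu E₁ N) (mu E₂ N) (muCarrierMap ψE.toMonoidHom N))
        (inv₁ : galoisCohomology (mu E₁ N) 2 →+ ZMod N) (inv₂ : galoisCohomology (mu E₂ N) 2 →+ ZMod N),
        IsInvariantMap E₁ N inv₁ → IsInvariantMap E₂ N inv₂ →
          inv₂.comp (cohTransport β (mu E₁ N) (mu E₂ N) (muCarrierMap ψE.toMonoidHom N) hμ 2) =
            inv₁ := by
  obtain ⟨β, ψE, hβ, hψE⟩ := exists_layerPair E₁ E₂ α hα ψ
  exact ⟨β, ψE, hβ, hψE, isAlphaEquivariant_layer hψ hβ hψE,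
    preservesUniformizers_layer hψ hu hunif hβ hψE,
    fun N _ _ _ hμ inv₁ inv₂ => layer_residueMap_compat hψ hu hunif hβ hψE N hμ inv₁ inv₂⟩

end Package

end Prop121vii

end Literature.AnabelianGeometry.AbsoluteAnabelian
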